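import Literature.MathematicalPhysics.QuantumFieldTheory.TorusLoopStaples
import Literature.MathematicalPhysics.QuantumFieldTheory.LatticeRPCauchySchwarz
import HarnessLib

/-!
# Log-convexity of rectangular Wilson loops on the even torus from link-plane reflection
positivity

For the torus Wilson state `μ_{Λ,β}` on the even torus `(ℤ/Lℤ)^d` (`β ≥ 0`, continuous matrix
representation `ρ` of the compact gauge group `G`) and the rectangular Wilson loops
`W(n, m) = ⟨W_{n×m}⟩_{Λ,β}` in the `(0, j)` coordinate plane (`n` steps in the time direction
`0`, `m` steps in a spatial direction `j`), this file proves the reflection-positivity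
inequalities coming from the reflection `θ t = 1 - t` in the hyperplane between the time slices
(`GaugeConfig.timeReflect`; its reflection positivity is the tree's
`wilsonExpectation_reflectionPositive_holds`, whose bookkeeping `WilsonRP.*` we reuse):

* `wilsonExpectation_wilsonLoop_nonneg_of_odd` — `0 ≤ W(2h+1, m)` (`h + 1 ≤ L/2`);
* `wilsonExpectation_wilsonLoop_sq_le_of_link` —
  `W(q + 1 + p, m)² ≤ W(2p+1, m) · W(2q+1, m)` (`p + 1, q + 1 ≤ L/2`).

These are the odd-height half of the log-convexity input of
`StringTension.hasStringTension_of_eventually` (static potential and string tension of limit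
states, named fact `exists_hasStringTension`); the even-height half needs the reflection in a
lattice hyperplane and is proved separately.

## The argument (Osterwalder–Seiler 1978 §2; Seiler LNP 159 §2)

Place the `(q + 1 + p) × m` loop symmetrically about the hyperplane `t = ½`: `q` time-like
links below the slice `0`, the crossing links `0 → 1`, `p` links above the slice `1`. After
Osterwalder–Seiler's splitting of the crossing link variables (`WilsonRP.translate`; this is how
the tree proves reflection positivity without gauge fixing) the loop holonomy of the translated
configuration is conjugate to `Φ_p(z) Φ_q(ΘU)⁻¹` (`StringTension.rectangleHolonomy_eq_conj_staples`
of `TorusLoopStaples`; `Φ_h` the extended staple, `z = splice_C(U, Y)`), so that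
`Z · e^{βN#plaq} · N · W(q+1+p, m) = Re B(Φ_p, Φ_q)` for the reflection-positive sesquilinear
form `B` of the abstract mechanism (`LatticeRP.integral_mul_conj_mul_exp_nonneg`), summed over
the matrix entries of the unitarised representation (`wilsonIntegral_eq_re_sum_pair`). The
Cauchy–Schwarz inequality for `B` (`LatticeRP.re_sum_pair_sq_le`) gives the claim at the
symmetric position, and translation invariance of the torus state
(`wilsonExpectation_wilsonLoop_eq_zero_base`) moves the three loops to the origin.
Everything here is proved; no definitions.

## References

* K. Osterwalder, E. Seiler, *Gauge field theories on a lattice*, Ann. Phys. 110 (1978) 440, §2.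
* E. Seiler, LNP 159 (1982), §2 (static quark potential from reflection positivity).
-/

noncomputable section

open MeasureTheory Finset Complex
open scoped ComplexOrder ComplexConjugate

namespace Literature.MathematicalPhysics.QuantumFieldTheory

namespace StringTension

open WilsonRP LatticeRP Literature.RepresentationTheory.CompactGroups

variable {d L N : ℕ} [NeZero d] [NeZero L] [Fact (1 < L)]
variable {G : Type*} [Group G] [TopologicalSpace G] [IsTopologicalGroup G] [CompactSpace G]
  [MeasurableSpace G] [BorelSpace G]
variable (ρ : G →* Matrix (Fin N) (Fin N) ℂ)

/-! ### Time coordinates of the links of the loop -/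

section Classification

variable {a : Site d L} {j : Fin d}

omit [NeZero L] [Fact (1 < L)] in
/-- Time coordinate above a base point of the slice `0`. [folklore] -/
theorem apply_zero_add_single_zero (ha : a 0 = 0) (t : ZMod L) :
    (a + Pi.single 0 t : Site d L) 0 = t := by
  rw [Pi.add_apply, ha, Pi.single_eq_same, zero_add]

omit [NeZero L] [Fact (1 < L)] in
/-- A spatial displacement does not change the time coordinate. [folklore] -/
theorem apply_zero_add_single_of_ne (y : Site d L) (hj : j ≠ (0 : Fin d)) (t : ZMod L) :
    (y + Pi.single j t : Site d L) 0 = y 0 := by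
  rw [Pi.add_apply, Pi.single_eq_of_ne (Ne.symm hj), add_zero]

/-- **The inner time-like links of a staple are positive**: the link from the slice `1 + s` to
`2 + s`, `s < h`, `h + 1 ≤ L/2`. [folklore] -/
theorem isPosEdge_leg (ha : a 0 = 0) {h : ℕ} (hh : h + 1 ≤ L / 2) {s : ℕ} (hs : s < h) :
    IsPosEdge ((a.shift 0 + Pi.single 0 ((s : ℕ) : ZMod L) : Site d L), (0 : Fin d)) := by
  have h1L : 1 < L := Fact.out
  have hL2 : L / 2 < L := Nat.div_lt_self (by omega) one_lt_two
  have hv : ((a.shift 0 + Pi.single 0 ((s : ℕ) : ZMod L) : Site d L) 0).val = s + 1 := by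
    rw [Pi.add_apply, Pi.single_eq_same, WilsonRP.shift_apply_self, ha, zero_add,
      show (1 : ZMod L) + ((s : ℕ) : ZMod L) = (((s + 1 : ℕ)) : ZMod L) by push_cast; ring,
      ZMod.val_cast_of_lt (by omega)]
  rw [isPosEdge_iff]
  simp only [↓reduceIte, hv]
  omega

/-- **The spatial links of the top of a staple are positive** (slice `h + 1 ≤ L/2`). [folklore] -/
theorem isPosEdge_top (ha : a 0 = 0) (hj : j ≠ 0) {h : ℕ} (hh : h + 1 ≤ L / 2) (r : ZMod L) :
    IsPosEdge ((a + Pi.single 0 (((h + 1 : ℕ)) : ZMod L) + Pi.single j r : Site d L), j) := by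
  have h1L : 1 < L := Fact.out
  have hL2 : L / 2 < L := Nat.div_lt_self (by omega) one_lt_two
  have hv : ((a + Pi.single 0 (((h + 1 : ℕ)) : ZMod L) + Pi.single j r : Site d L) 0).val = h + 1 := by
    rw [apply_zero_add_single_of_ne _ hj, apply_zero_add_single_zero ha, ZMod.val_cast_of_lt (by omega)]
  rw [isPosEdge_iff]
  simp only [hj, ↓reduceIte, hv]
  omega

omit [NeZero L] [Fact (1 < L)] in
/-- The link from a base point of the slice `0` to the slice `1` is a lower crossing link.
[folklore] -/
theorem isLowerCross_of_apply_zero (ha : a 0 = 0) : IsLowerCross ((a : Site d L), (0 : Fin d)) :=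
  ⟨rfl, by simp [ha]⟩

/-- **The time-like links below the slice `0` of the loop are not crossing** (`L` even,
`q + 1 ≤ L/2`): the link from the slice `-(q - r)` upwards, `r < q`. [folklore] -/
theorem not_isCrossEdge_lower (hL : Even L) (ha : a 0 = 0) {q : ℕ} (hq : q + 1 ≤ L / 2) {r : ℕ}
    (hr : r < q) :
    ¬ IsCrossEdge ((a + Pi.single 0 (-((q : ℕ) : ZMod L)) + Pi.single 0 ((r : ℕ) : ZMod L) : Site d L),
      (0 : Fin d)) := by
  have h1L : 1 < L := Fact.out
  have hE := Nat.even_iff.mp hL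
  have hL2 : L / 2 < L := Nat.div_lt_self (by omega) one_lt_two
  have hqr : 0 < q - r := Nat.sub_pos_of_lt hr
  have hcast : (-((q : ℕ) : ZMod L)) + ((r : ℕ) : ZMod L) = -(((q - r : ℕ)) : ZMod L) := by
    rw [Nat.cast_sub hr.le]; ring
  have hne : (((q - r : ℕ)) : ZMod L) ≠ 0 := by
    intro h0
    have := congrArg ZMod.val h0
    rw [ZMod.val_cast_of_lt (by omega), ZMod.val_zero] at this
    omega
  have hv : ((a + Pi.single 0 (-((q : ℕ) : ZMod L)) + Pi.single 0 ((r : ℕ) : ZMod L) : Site d L) 0).val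
      = L - (q - r) := by
    rw [add_assoc, ← Pi.single_add, apply_zero_add_single_zero ha, hcast, ZMod.neg_val, if_neg hne,
      ZMod.val_cast_of_lt (by omega)]
  rintro ⟨-, h0 | h0⟩ <;> simp only [hv] at h0 <;> omega

end Classification

/-! ### The translated and spliced configurations on the lines of the loop -/

section Lines

variable {a : Site d L} {j : Fin d}

omit [NeZero L] [Fact (1 < L)] [TopologicalSpace G] [IsTopologicalGroup G] [CompactSpace G]
  [MeasurableSpace G] [BorelSpace G] in
/-- `translate` does not change spatial lines. [folklore] -/
theorem lineHolonomy_translate_of_ne_zero (hj : j ≠ 0) (Y U : GaugeConfig d L G) (n : ℕ)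
    (y : Site d L) : lineHolonomy (WilsonRP.translate Y U) j n y = lineHolonomy U j n y :=
  lineHolonomy_congr j n y fun _ _ => translate_apply_of_ne_zero Y U hj

omit [Fact (1 < L)] [Group G] [TopologicalSpace G] [IsTopologicalGroup G] [CompactSpace G]
  [MeasurableSpace G] [BorelSpace G] in
/-- `splice_C` does not change spatial lines. [folklore] -/
theorem lineHolonomy_splice_of_ne_zero [Group G] (hj : j ≠ 0) (U Y : GaugeConfig d L G) (n : ℕ)
    (y : Site d L) : lineHolonomy (splice crossEdges (U, Y)) j n y = lineHolonomy U j n y :=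
  lineHolonomy_congr j n y fun _ _ => splice_apply_of_not_isCrossEdge U Y fun h => hj h.1

omit [TopologicalSpace G] [IsTopologicalGroup G] [CompactSpace G] [MeasurableSpace G]
  [BorelSpace G] in
/-- `translate` does not change the time-like lines of the loop below the slice `0`. [folklore] -/
theorem lineHolonomy_translate_lower (hL : Even L) (ha : a 0 = 0) {q : ℕ} (hq : q + 1 ≤ L / 2)
    (Y U : GaugeConfig d L G) :
    lineHolonomy (WilsonRP.translate Y U) 0 q (a + Pi.single 0 (-((q : ℕ) : ZMod L))) =
      lineHolonomy U 0 q (a + Pi.single 0 (-((q : ℕ) : ZMod L))) :=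
  lineHolonomy_congr 0 q _ fun _ hr =>
    translate_apply_of_not_isCrossEdge Y U (not_isCrossEdge_lower hL ha hq hr)

omit [TopologicalSpace G] [IsTopologicalGroup G] [CompactSpace G] [MeasurableSpace G]
  [BorelSpace G] in
/-- `translate` does not change the inner time-like links of a staple. [folklore] -/
theorem lineHolonomy_translate_leg (hL : Even L) (ha : a 0 = 0) {h : ℕ} (hh : h + 1 ≤ L / 2)
    (Y U : GaugeConfig d L G) :
    lineHolonomy (WilsonRP.translate Y U) 0 h (a.shift 0) = lineHolonomy U 0 h (a.shift 0) :=
  lineHolonomy_congr 0 h _ fun _ hs => translate_apply_of_not_isCrossEdge Y U fun hc =>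
    not_isPosEdge_of_isCrossEdge hL hc (isPosEdge_leg ha hh hs)

omit [Group G] [TopologicalSpace G] [IsTopologicalGroup G] [CompactSpace G] [MeasurableSpace G]
  [BorelSpace G] in
/-- `splice_C` does not change the inner time-like links of a staple. [folklore] -/
theorem lineHolonomy_splice_leg [Group G] (hL : Even L) (ha : a 0 = 0) {h : ℕ} (hh : h + 1 ≤ L / 2)
    (U Y : GaugeConfig d L G) :
    lineHolonomy (splice crossEdges (U, Y)) 0 h (a.shift 0) = lineHolonomy U 0 h (a.shift 0) :=
  lineHolonomy_congr 0 h _ fun _ hs => splice_apply_of_not_isCrossEdge U Y fun hc =>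
    not_isPosEdge_of_isCrossEdge hL hc (isPosEdge_leg ha hh hs)

omit [TopologicalSpace G] [IsTopologicalGroup G] [CompactSpace G] [MeasurableSpace G]
  [BorelSpace G] in
/-- **The inner staples of `WilsonRP.translate Y U` and of `splice_C(U, Y)` agree** (both equal the inner
staple of `U`: no crossing link is involved). [folklore] -/
theorem innerStaple_translate_eq_splice (hL : Even L) (ha : a 0 = 0) (hj : j ≠ 0) {h : ℕ}
    (hh : h + 1 ≤ L / 2) (m : ℕ) (U Y : GaugeConfig d L G) :
    lineHolonomy (WilsonRP.translate Y U) 0 h (a.shift 0) *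
        lineHolonomy (WilsonRP.translate Y U) j m (a + Pi.single 0 (((h + 1 : ℕ)) : ZMod L)) *
        (lineHolonomy (WilsonRP.translate Y U) 0 h ((a + Pi.single j ((m : ℕ) : ZMod L)).shift 0))⁻¹ =
      lineHolonomy (splice crossEdges (U, Y)) 0 h (a.shift 0) *
        lineHolonomy (splice crossEdges (U, Y)) j m (a + Pi.single 0 (((h + 1 : ℕ)) : ZMod L)) *
        (lineHolonomy (splice crossEdges (U, Y)) 0 h ((a + Pi.single j ((m : ℕ) : ZMod L)).shift 0))⁻¹ := by
  have ha' : (a + Pi.single j ((m : ℕ) : ZMod L) : Site d L) 0 = 0 := add_single_apply_zero_of_ne ha hj _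
  rw [lineHolonomy_translate_leg hL ha hh, lineHolonomy_translate_leg hL ha' hh,
    lineHolonomy_translate_of_ne_zero hj, lineHolonomy_splice_leg hL ha hh,
    lineHolonomy_splice_leg hL ha' hh, lineHolonomy_splice_of_ne_zero hj]

omit [TopologicalSpace G] [IsTopologicalGroup G] [CompactSpace G] [MeasurableSpace G]
  [BorelSpace G] in
/-- **The extended staple depends only on the positive and the crossing links.** [folklore] -/
theorem staple_congr (ha : a 0 = 0) (hj : j ≠ 0) {h : ℕ} (hh : h + 1 ≤ L / 2) (m : ℕ)
    {V V' : GaugeConfig d L G}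
    (hVV' : ∀ e ∈ ((posEdges ∪ crossEdges : Finset (Edge d L)) : Set (Edge d L)), V e = V' e) :
    lineHolonomy V 0 (h + 1) a * lineHolonomy V j m (a + Pi.single 0 (((h + 1 : ℕ)) : ZMod L)) *
        (lineHolonomy V 0 (h + 1) (a + Pi.single j ((m : ℕ) : ZMod L)))⁻¹ =
      lineHolonomy V' 0 (h + 1) a * lineHolonomy V' j m (a + Pi.single 0 (((h + 1 : ℕ)) : ZMod L)) *
        (lineHolonomy V' 0 (h + 1) (a + Pi.single j ((m : ℕ) : ZMod L)))⁻¹ := by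
  have hP : ∀ e, IsPosEdge e → V e = V' e := fun e he => hVV' e (by simp [he])
  have hC : ∀ e, IsCrossEdge e → V e = V' e := fun e he => hVV' e (by simp [he])
  -- an extended leg from a base point `b` of the slice `0`
  have hleg : ∀ b : Site d L, b 0 = 0 → lineHolonomy V 0 (h + 1) b = lineHolonomy V' 0 (h + 1) b := by
    intro b hb
    rw [lineHolonomy_succ, lineHolonomy_succ, hC _ (isLowerCross_of_apply_zero hb).isCrossEdge]
    congr 1
    exact lineHolonomy_congr 0 h _ fun s hs => hP _ (isPosEdge_leg hb hh hs)
  have ha' : (a + Pi.single j ((m : ℕ) : ZMod L) : Site d L) 0 = 0 := add_single_apply_zero_of_ne ha hj _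
  rw [hleg a ha, hleg _ ha', lineHolonomy_congr j m _ fun r _ => hP _ (isPosEdge_top ha hj hh _)]

end Lines

/-! ### The entries of the unitarised extended staple -/

section Entries

variable {a : Site d L} {j : Fin d}

omit [NeZero L] [Fact (1 < L)] in
/-- The matrix entries of the unitarised extended staple are measurable. [folklore] -/
theorem measurable_unitarize_staple (hρ : Continuous ρ) (h m : ℕ) (k l : Fin N) :
    Measurable fun V : GaugeConfig d L G =>
      CompactGroup.unitarize ρ hρ (lineHolonomy V 0 (h + 1) a *
        lineHolonomy V j m (a + Pi.single 0 (((h + 1 : ℕ)) : ZMod L)) *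
        (lineHolonomy V 0 (h + 1) (a + Pi.single j ((m : ℕ) : ZMod L)))⁻¹) k l := by
  have hσ := CompactGroup.continuous_unitarize ρ hρ
  exact (((entryMeasurable_lineHolonomy hσ 0 (h + 1) a).mul
    (entryMeasurable_lineHolonomy hσ j m _)).mul (entryMeasurable_lineHolonomy_inv hσ 0 (h + 1) _)) k l

omit [NeZero L] [Fact (1 < L)] [MeasurableSpace G] [BorelSpace G] in
/-- The matrix entries of the unitarised extended staple are bounded by `1`. [folklore] -/
theorem norm_unitarize_staple_le (hρ : Continuous ρ) (h m : ℕ) (k l : Fin N) (V : GaugeConfig d L G) :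
    ‖CompactGroup.unitarize ρ hρ (lineHolonomy V 0 (h + 1) a *
        lineHolonomy V j m (a + Pi.single 0 (((h + 1 : ℕ)) : ZMod L)) *
        (lineHolonomy V 0 (h + 1) (a + Pi.single j ((m : ℕ) : ZMod L)))⁻¹) k l‖ ≤ 1 :=
  CompactGroup.norm_unitarize_apply_le_one ρ hρ _ _ _

omit [MeasurableSpace G] [BorelSpace G] in
/-- The observable `g = σ(Φ_h)_{kl} · e^{βA}` entering the reflection-positive form depends only
on the positive and crossing links. [folklore] -/
theorem dependsOn_gObs_staple (hρ : Continuous ρ) (β : ℝ) (ha : a 0 = 0) (hj : j ≠ 0)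
    {h : ℕ} (hh : h + 1 ≤ L / 2) (m : ℕ) (k l : Fin N) :
    DependsOn (gObs ρ β fun V : GaugeConfig d L G =>
      CompactGroup.unitarize ρ hρ (lineHolonomy V 0 (h + 1) a *
        lineHolonomy V j m (a + Pi.single 0 (((h + 1 : ℕ)) : ZMod L)) *
        (lineHolonomy V 0 (h + 1) (a + Pi.single j ((m : ℕ) : ZMod L)))⁻¹) k l)
      ((posEdges ∪ crossEdges : Finset (Edge d L)) : Set (Edge d L)) := by
  intro V V' hVV'
  have hP : ∀ e ∈ ((posEdges : Finset (Edge d L)) : Set (Edge d L)), V e = V' e := fun e he =>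
    hVV' e (by rw [Finset.coe_union]; exact Or.inl he)
  simp only [gObs, staple_congr ha hj hh m hVV', dependsOn_posAction ρ hP]

end Entries


/-! ### The Wilson expectation as an integral against the product Haar measure -/

section Expectation

omit [NeZero d] [Fact (1 < L)] in
/-- **The torus Wilson expectation of a real observable** is `Z⁻¹ ∫ e^{-β S(U)} F(U) ∏ dU_e`
(`wilsonMeasure = Z⁻¹ • (∏ Haar).withDensity e^{-βS}`). Unlike the tree's
`QuantumLattice.wilsonExpectation_eq_toReal_mul_integral` (`LatticeGaugeDLRGibbsProofs`, which
assumes `[SecondCountableTopology G]` and imports the continuum-limit files) no second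
countability of `G` is assumed here: measurability of the Wilson action goes through the matrix
entries of the continuous representation (`WilsonRP.measurable_wilsonAction`). [folklore] -/
theorem wilsonExpectation_real_eq_toReal_mul_integral (hρ : Continuous ρ) (β : ℝ)
    (F : GaugeConfig d L G → ℝ) :
    wilsonExpectation ρ β F = ((partitionFunction (d := d) (L := L) ρ β)⁻¹).toReal *
      ∫ U, Real.exp (-β * wilsonAction ρ U) * F U ∂(LatticeRP.piMeasure (haarProbability G)) := by
  have hdens : Measurable fun U : GaugeConfig d L G =>
      ENNReal.ofReal (Real.exp (-β * wilsonAction ρ U)) :=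
    ENNReal.measurable_ofReal.comp ((WilsonRP.measurable_wilsonAction ρ hρ).const_mul (-β)).exp
  unfold wilsonExpectation wilsonMeasure
  rw [integral_smul_measure]
  unfold wilsonWeight
  rw [integral_withDensity_eq_integral_toReal_smul hdens (ae_of_all _ fun _ => ENNReal.ofReal_lt_top)]
  simp_rw [ENNReal.toReal_ofReal (Real.exp_nonneg _), smul_eq_mul]

omit [NeZero d] [NeZero L] [Fact (1 < L)] [CompactSpace G] in
/-- The rectangular Wilson loop observable is measurable. [folklore] -/
theorem measurable_wilsonLoop (hρ : Continuous ρ) (x : Site d L) (i j : Fin d) (R T : ℕ) :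
    Measurable (wilsonLoop ρ x i j R T : GaugeConfig d L G → ℝ) := by
  unfold wilsonLoop rectangleHolonomy
  exact ((((entryMeasurable_lineHolonomy hρ i R x).mul (entryMeasurable_lineHolonomy hρ j T _)).mul
    (entryMeasurable_lineHolonomy_inv hρ i R _)).mul
    (entryMeasurable_lineHolonomy_inv hρ j T _)).measurable_trace_re.const_mul _

end Expectation

/-! ### The loop integral in the doubled variables -/

section Bridge

variable {a : Site d L} {j : Fin d}

omit [MeasurableSpace G] [BorelSpace G] in
/-- **The weighted loop after splitting the crossing links** (pointwise identity). For `U, Y`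
and `V = WilsonRP.translate Y U`, `z = splice_C(U, Y)`:
`e^{-β S(V)} W_{(q+1+p)×m}(V) = e^{-βN#plaq} N⁻¹ Re ∑_{kl} g^p_{kl}(z) conj g^q_{kl}(ΘU) K(U,Y)`
with `g^h_{kl} = σ(Φ_h)_{kl} e^{βA}` and the crossing Gram kernel `K = exp(∑ᵢ aᵢ(z) conj aᵢ(ΘU))`
(`WilsonRP.wilsonAction_split`, `WilsonRP.sum_coeff_mul_conj`,
`re_trace_rectangleHolonomy_eq_sum`). [folklore] -/
theorem weight_mul_wilsonLoop_translate (hL : Even L) (hρ : Continuous ρ) {β : ℝ} (hβ : 0 ≤ β)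
    (ha : a 0 = 0) (hj : j ≠ 0) {p q : ℕ} (hp : p + 1 ≤ L / 2) (hq : q + 1 ≤ L / 2) (m : ℕ)
    (U Y : GaugeConfig d L G) :
    Real.exp (-β * wilsonAction ρ (WilsonRP.translate Y U)) *
        wilsonLoop ρ (a + Pi.single 0 (-((q : ℕ) : ZMod L))) 0 j (q + (p + 1)) m (WilsonRP.translate Y U) =
      Real.exp (-β * (N * Fintype.card (Plaquette d L))) * (N : ℝ)⁻¹ *
        (∑ kl : Fin N × Fin N,
          gObs ρ β (fun V : GaugeConfig d L G => CompactGroup.unitarize ρ hρ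
              (lineHolonomy V 0 (p + 1) a * lineHolonomy V j m (a + Pi.single 0 (((p + 1 : ℕ)) : ZMod L)) *
                (lineHolonomy V 0 (p + 1) (a + Pi.single j ((m : ℕ) : ZMod L)))⁻¹) kl.1 kl.2)
              (splice crossEdges (U, Y)) *
            conj (gObs ρ β (fun V : GaugeConfig d L G => CompactGroup.unitarize ρ hρ
              (lineHolonomy V 0 (q + 1) a * lineHolonomy V j m (a + Pi.single 0 (((q + 1 : ℕ)) : ZMod L)) *
                (lineHolonomy V 0 (q + 1) (a + Pi.single j ((m : ℕ) : ZMod L)))⁻¹) kl.1 kl.2)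
              U.timeReflect) *
            Complex.exp (∑ i, coeff ρ hρ β i (splice crossEdges (U, Y)) *
              conj (coeff ρ hρ β i U.timeReflect))).re := by
  have ha' : (a + Pi.single j ((m : ℕ) : ZMod L) : Site d L) 0 = 0 := add_single_apply_zero_of_ne ha hj _
  -- the positive part of the action in the three configurations
  have hPC : ∀ e : Edge d L, IsPosEdge e → ¬ IsCrossEdge e :=
    fun e he hc => not_isPosEdge_of_isCrossEdge hL hc he
  have hmem : ∀ e : Edge d L, e ∈ ((posEdges : Finset (Edge d L)) : Set (Edge d L)) → IsPosEdge e :=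
    fun e he => by simpa using he
  have htr : ∀ e ∈ ((posEdges : Finset (Edge d L)) : Set (Edge d L)), WilsonRP.translate Y U e = U e :=
    fun e he => translate_apply_of_not_isCrossEdge Y U (hPC e (hmem e he))
  have hsp : ∀ e ∈ ((posEdges : Finset (Edge d L)) : Set (Edge d L)),
      splice crossEdges (U, Y) e = U e :=
    fun e he => splice_apply_of_not_isCrossEdge U Y (hPC e (hmem e he))
  have hΘtr : ∀ e ∈ ((posEdges : Finset (Edge d L)) : Set (Edge d L)),
      (WilsonRP.translate Y U).timeReflect e = U.timeReflect e := by
    intro e he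
    rw [timeReflect_apply, timeReflect_apply,
      translate_apply_of_not_isCrossEdge Y U (not_isCrossEdge_edgeReflect hL (hmem e he))]
  have hA1 : posAction ρ (WilsonRP.translate Y U) = posAction ρ U := dependsOn_posAction ρ htr
  have hA2 : posAction ρ (WilsonRP.translate Y U).timeReflect = posAction ρ U.timeReflect :=
    dependsOn_posAction ρ hΘtr
  have hA3 : posAction ρ (splice crossEdges (U, Y)) = posAction ρ U := dependsOn_posAction ρ hsp
  -- the crossing kernel is real
  have hK : Complex.exp (∑ i, coeff ρ hρ β i (splice crossEdges (U, Y)) *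
      conj (coeff ρ hρ β i U.timeReflect)) =
      ((Real.exp (β * crossAction ρ (WilsonRP.translate Y U)) : ℝ) : ℂ) := by
    rw [sum_coeff_mul_conj ρ hL hρ hβ, Complex.ofReal_exp]
  -- the loop as a scalar product of staples
  have htrace := re_trace_rectangleHolonomy_eq_sum ρ hρ U (WilsonRP.translate Y U) (splice crossEdges (U, Y)) Y
    ha hj q p m (lineHolonomy_translate_lower hL ha hq Y U)
    (by rw [add_single_add_single_comm]; exact lineHolonomy_translate_lower hL ha' hq Y U)
    (lineHolonomy_translate_of_ne_zero hj Y U m _)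
    (translate_apply_of_isLowerCross Y U (isLowerCross_of_apply_zero ha))
    (translate_apply_of_isLowerCross Y U (isLowerCross_of_apply_zero ha'))
    (splice_apply_of_isCrossEdge U Y (isLowerCross_of_apply_zero ha).isCrossEdge)
    (splice_apply_of_isCrossEdge U Y (isLowerCross_of_apply_zero ha').isCrossEdge)
    (innerStaple_translate_eq_splice hL ha hj hp m U Y)
  -- assemble
  rw [wilsonLoop, htrace, wilsonAction_split ρ hL hρ, hA1, hA2]
  simp only [gObs, hA3, hK, map_mul (starRingEnd ℂ), Complex.conj_ofReal]
  rw [Fintype.sum_prod_type]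
  simp only [Complex.re_sum]
  have hterm : ∀ (u v : ℂ),
      (u * ((Real.exp (β * posAction ρ U) : ℝ) : ℂ) * (conj v * ((Real.exp (β * posAction ρ U.timeReflect) : ℝ) : ℂ)) *
        ((Real.exp (β * crossAction ρ (WilsonRP.translate Y U)) : ℝ) : ℂ)).re =
      Real.exp (β * posAction ρ U) * Real.exp (β * posAction ρ U.timeReflect) *
        Real.exp (β * crossAction ρ (WilsonRP.translate Y U)) * (u * conj v).re := by
    intro u v
    have : u * ((Real.exp (β * posAction ρ U) : ℝ) : ℂ) * (conj v * ((Real.exp (β * posAction ρ U.timeReflect) : ℝ) : ℂ)) *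
        ((Real.exp (β * crossAction ρ (WilsonRP.translate Y U)) : ℝ) : ℂ) =
      ((Real.exp (β * posAction ρ U) * Real.exp (β * posAction ρ U.timeReflect) *
        Real.exp (β * crossAction ρ (WilsonRP.translate Y U)) : ℝ) : ℂ) * (u * conj v) := by push_cast; ring
    rw [this, Complex.re_ofReal_mul]
  simp only [hterm, ← Finset.mul_sum]
  rw [show -β * (↑N * ↑(Fintype.card (Plaquette d L)) -
      (posAction ρ U + posAction ρ U.timeReflect + crossAction ρ (WilsonRP.translate Y U))) =
    -β * (↑N * ↑(Fintype.card (Plaquette d L))) + β * posAction ρ U +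
      β * posAction ρ U.timeReflect + β * crossAction ρ (WilsonRP.translate Y U) by ring,
    Real.exp_add, Real.exp_add, Real.exp_add]
  ring

end Bridge


/-! ### The loop integral as the real part of the reflection-positive form -/

section Form

variable {a : Site d L} {j : Fin d}

/-- **The weighted loop integral is `e^{-βN#plaq} N⁻¹ Re B(Φ_p, Φ_q)`**, where
`B(Φ_p, Φ_q) = ∑_{kl} ∫∫ g^p_{kl}(z) conj g^q_{kl}(ΘU) K(U, Y) dU dY` is the reflection-positive
form of the abstract mechanism evaluated on the entries of the two extended staples (splitting
of the crossing links by Haar invariance, `WilsonRP.measurePreserving_translate`, and the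
pointwise identity `weight_mul_wilsonLoop_translate`). [folklore] -/
theorem wilsonIntegral_eq_re_sum_pair (hL : Even L) (hρ : Continuous ρ) {β : ℝ} (hβ : 0 ≤ β)
    (ha : a 0 = 0) (hj : j ≠ 0) {p q : ℕ} (hp : p + 1 ≤ L / 2) (hq : q + 1 ≤ L / 2) (m : ℕ) :
    ∫ U, Real.exp (-β * wilsonAction ρ U) *
        wilsonLoop ρ (a + Pi.single 0 (-((q : ℕ) : ZMod L))) 0 j (q + (p + 1)) m U
      ∂(LatticeRP.piMeasure (haarProbability G)) =
    Real.exp (-β * (N * Fintype.card (Plaquette d L))) * (N : ℝ)⁻¹ *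
      (∑ kl : Fin N × Fin N, ∫ pp,
        gObs ρ β (fun V : GaugeConfig d L G => CompactGroup.unitarize ρ hρ
            (lineHolonomy V 0 (p + 1) a * lineHolonomy V j m (a + Pi.single 0 (((p + 1 : ℕ)) : ZMod L)) *
              (lineHolonomy V 0 (p + 1) (a + Pi.single j ((m : ℕ) : ZMod L)))⁻¹) kl.1 kl.2)
            (splice crossEdges pp) *
          conj (gObs ρ β (fun V : GaugeConfig d L G => CompactGroup.unitarize ρ hρ
            (lineHolonomy V 0 (q + 1) a * lineHolonomy V j m (a + Pi.single 0 (((q + 1 : ℕ)) : ZMod L)) *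
              (lineHolonomy V 0 (q + 1) (a + Pi.single j ((m : ℕ) : ZMod L)))⁻¹) kl.1 kl.2)
            (GaugeConfig.timeReflect pp.1)) *
          Complex.exp (∑ i, coeff ρ hρ β i (splice crossEdges pp) * conj (coeff ρ hρ β i (GaugeConfig.timeReflect pp.1)))
        ∂((LatticeRP.piMeasure (haarProbability G)).prod (LatticeRP.piMeasure (haarProbability G)))).re := by
  set μH : Measure (GaugeConfig d L G) := LatticeRP.piMeasure (haarProbability G) with hμH
  -- the two families of entries
  set gp : Fin N × Fin N → GaugeConfig d L G → ℂ := fun kl =>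
    gObs ρ β (fun V : GaugeConfig d L G => CompactGroup.unitarize ρ hρ
      (lineHolonomy V 0 (p + 1) a * lineHolonomy V j m (a + Pi.single 0 (((p + 1 : ℕ)) : ZMod L)) *
        (lineHolonomy V 0 (p + 1) (a + Pi.single j ((m : ℕ) : ZMod L)))⁻¹) kl.1 kl.2) with hgp
  set gq : Fin N × Fin N → GaugeConfig d L G → ℂ := fun kl =>
    gObs ρ β (fun V : GaugeConfig d L G => CompactGroup.unitarize ρ hρ
      (lineHolonomy V 0 (q + 1) a * lineHolonomy V j m (a + Pi.single 0 (((q + 1 : ℕ)) : ZMod L)) *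
        (lineHolonomy V 0 (q + 1) (a + Pi.single j ((m : ℕ) : ZMod L)))⁻¹) kl.1 kl.2) with hgq
  have hgpm : ∀ kl, Measurable (gp kl) := fun kl =>
    measurable_gObs ρ hρ β (measurable_unitarize_staple ρ hρ p m kl.1 kl.2)
  have hgqm : ∀ kl, Measurable (gq kl) := fun kl =>
    measurable_gObs ρ hρ β (measurable_unitarize_staple ρ hρ q m kl.1 kl.2)
  have hgpb : ∀ kl U, ‖gp kl U‖ ≤ |(1 : ℝ)| * Real.exp (β * (N * Fintype.card (Plaquette d L))) :=
    fun kl U => norm_gObs_le ρ hρ hβ (fun V => norm_unitarize_staple_le ρ hρ p m kl.1 kl.2 V) U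
  have hgqb : ∀ kl U, ‖gq kl U‖ ≤ |(1 : ℝ)| * Real.exp (β * (N * Fintype.card (Plaquette d L))) :=
    fun kl U => norm_gObs_le ρ hρ hβ (fun V => norm_unitarize_staple_le ρ hρ q m kl.1 kl.2 V) U
  -- the doubled integrand
  set S : GaugeConfig d L G × GaugeConfig d L G → ℂ := fun pp => ∑ kl : Fin N × Fin N,
    gp kl (splice crossEdges pp) * conj (gq kl (GaugeConfig.timeReflect pp.1)) *
      Complex.exp (∑ i, coeff ρ hρ β i (splice crossEdges pp) * conj (coeff ρ hρ β i (GaugeConfig.timeReflect pp.1)))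
    with hS
  have hSi' : ∀ kl, Integrable (fun pp : GaugeConfig d L G × GaugeConfig d L G =>
      gp kl (splice crossEdges pp) * conj (gq kl (GaugeConfig.timeReflect pp.1)) *
        Complex.exp (∑ i, coeff ρ hρ β i (splice crossEdges pp) * conj (coeff ρ hρ β i (GaugeConfig.timeReflect pp.1))))
      (μH.prod μH) := fun kl =>
    integrable_pairIntegrand (haarProbability G) crossEdges GaugeConfig.timeReflect (coeff ρ hρ β)
      measurable_timeReflect (hgpm kl) (hgqm kl) (fun i => measurable_coeff ρ hρ β i) (hgpb kl) (hgqb kl)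
      (fun i U => norm_coeff_le ρ hρ β i U)
  have hSi : Integrable S (μH.prod μH) := by
    simpa only [hS] using integrable_finsetSum _ fun kl _ => hSi' kl
  set κ : ℝ := Real.exp (-β * (N * Fintype.card (Plaquette d L))) * (N : ℝ)⁻¹ with hκ
  -- the weighted loop
  set F : GaugeConfig d L G → ℝ := fun U => Real.exp (-β * wilsonAction ρ U) *
    wilsonLoop ρ (a + Pi.single 0 (-((q : ℕ) : ZMod L))) 0 j (q + (p + 1)) m U with hF
  have hFm : Measurable F :=
    (((WilsonRP.measurable_wilsonAction ρ hρ).const_mul (-β)).exp).mul (measurable_wilsonLoop ρ hρ _ _ _ _ _)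
  have hpt : ∀ U Y, F (WilsonRP.translate Y U) = κ * (S (U, Y)).re := fun U Y =>
    weight_mul_wilsonLoop_translate ρ hL hρ hβ ha hj hp hq m U Y
  -- Step 1: split the crossing links for every `Y`
  have step1 : ∀ Y, ∫ U, F U ∂μH = ∫ U, κ * (S (U, Y)).re ∂μH := by
    intro Y
    have h1 : ∫ U, F (WilsonRP.translate Y U) ∂μH = ∫ U, F U ∂μH := by
      rw [← integral_map (measurePreserving_translate Y).measurable.aemeasurable
        hFm.aestronglyMeasurable, (measurePreserving_translate Y).map_eq]
    rw [← h1]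
    exact integral_congr_ae (ae_of_all _ fun U => hpt U Y)
  -- Step 2: integrate over `Y` and pass to the product
  have hDi : Integrable (fun pp : GaugeConfig d L G × GaugeConfig d L G => κ * (S pp).re) (μH.prod μH) :=
    hSi.re.const_mul κ
  have step2 : ∫ U, F U ∂μH = ∫ pp, κ * (S pp).re ∂(μH.prod μH) := by
    calc ∫ U, F U ∂μH = ∫ _Y, (∫ U, F U ∂μH) ∂μH := by rw [integral_const, probReal_univ, one_smul]
      _ = ∫ Y, ∫ U, κ * (S (U, Y)).re ∂μH ∂μH := integral_congr_ae (ae_of_all _ step1)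
      _ = ∫ pp, κ * (S pp).re ∂(μH.prod μH) := (integral_prod_symm _ hDi).symm
  -- Step 3: constants and real part out, sum out
  rw [step2, integral_const_mul]
  congr 1
  have hre := integral_re hSi
  simp only [RCLike.re_to_complex] at hre
  rw [hre, hS, integral_finsetSum _ fun kl _ => hSi' kl]

/-- **Cauchy–Schwarz for the weighted loop integrals at the symmetric position.** With
`I(q, p) = ∫ e^{-βS} W_{(q+1+p)×m}` for the loop placed with `q` links below and `p` links above
the reflection hyperplane: `0 ≤ I(p, p)` and `I(q, p)² ≤ I(p, p) · I(q, q)`. [folklore] -/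
theorem wilsonIntegral_sq_le (hL : Even L) (hρ : Continuous ρ) {β : ℝ} (hβ : 0 ≤ β)
    (ha : a 0 = 0) (hj : j ≠ 0) {p q : ℕ} (hp : p + 1 ≤ L / 2) (hq : q + 1 ≤ L / 2) (m : ℕ) :
    0 ≤ ∫ U, Real.exp (-β * wilsonAction ρ U) *
        wilsonLoop ρ (a + Pi.single 0 (-((p : ℕ) : ZMod L))) 0 j (p + (p + 1)) m U
          ∂(LatticeRP.piMeasure (haarProbability G)) ∧
    (∫ U, Real.exp (-β * wilsonAction ρ U) *
        wilsonLoop ρ (a + Pi.single 0 (-((q : ℕ) : ZMod L))) 0 j (q + (p + 1)) m U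
          ∂(LatticeRP.piMeasure (haarProbability G))) ^ 2 ≤
      (∫ U, Real.exp (-β * wilsonAction ρ U) *
        wilsonLoop ρ (a + Pi.single 0 (-((p : ℕ) : ZMod L))) 0 j (p + (p + 1)) m U
          ∂(LatticeRP.piMeasure (haarProbability G))) *
      (∫ U, Real.exp (-β * wilsonAction ρ U) *
        wilsonLoop ρ (a + Pi.single 0 (-((q : ℕ) : ZMod L))) 0 j (q + (q + 1)) m U
          ∂(LatticeRP.piMeasure (haarProbability G))) := by
  rw [wilsonIntegral_eq_re_sum_pair ρ hL hρ hβ ha hj hp hp m,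
    wilsonIntegral_eq_re_sum_pair ρ hL hρ hβ ha hj hp hq m,
    wilsonIntegral_eq_re_sum_pair ρ hL hρ hβ ha hj hq hq m]
  set gp : Fin N × Fin N → GaugeConfig d L G → ℂ := fun kl =>
    gObs ρ β (fun V : GaugeConfig d L G => CompactGroup.unitarize ρ hρ
      (lineHolonomy V 0 (p + 1) a * lineHolonomy V j m (a + Pi.single 0 (((p + 1 : ℕ)) : ZMod L)) *
        (lineHolonomy V 0 (p + 1) (a + Pi.single j ((m : ℕ) : ZMod L)))⁻¹) kl.1 kl.2) with hgp
  set gq : Fin N × Fin N → GaugeConfig d L G → ℂ := fun kl =>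
    gObs ρ β (fun V : GaugeConfig d L G => CompactGroup.unitarize ρ hρ
      (lineHolonomy V 0 (q + 1) a * lineHolonomy V j m (a + Pi.single 0 (((q + 1 : ℕ)) : ZMod L)) *
        (lineHolonomy V 0 (q + 1) (a + Pi.single j ((m : ℕ) : ZMod L)))⁻¹) kl.1 kl.2) with hgq
  have hgpm : ∀ kl, Measurable (gp kl) := fun kl =>
    measurable_gObs ρ hρ β (measurable_unitarize_staple ρ hρ p m kl.1 kl.2)
  have hgqm : ∀ kl, Measurable (gq kl) := fun kl =>
    measurable_gObs ρ hρ β (measurable_unitarize_staple ρ hρ q m kl.1 kl.2)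
  have hgpb : ∀ kl U, ‖gp kl U‖ ≤ |(1 : ℝ)| * Real.exp (β * (N * Fintype.card (Plaquette d L))) :=
    fun kl U => norm_gObs_le ρ hρ hβ (fun V => norm_unitarize_staple_le ρ hρ p m kl.1 kl.2 V) U
  have hgqb : ∀ kl U, ‖gq kl U‖ ≤ |(1 : ℝ)| * Real.exp (β * (N * Fintype.card (Plaquette d L))) :=
    fun kl U => norm_gObs_le ρ hρ hβ (fun V => norm_unitarize_staple_le ρ hρ q m kl.1 kl.2 V) U
  have hgpd : ∀ kl, DependsOn (gp kl)
      ((posEdges ∪ crossEdges ∪ ∅ : Finset (Edge d L)) : Set (Edge d L)) := fun kl => by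
    rw [Finset.union_empty]; exact dependsOn_gObs_staple ρ hρ β ha hj hp m kl.1 kl.2
  have hgqd : ∀ kl, DependsOn (gq kl)
      ((posEdges ∪ crossEdges ∪ ∅ : Finset (Edge d L)) : Set (Edge d L)) := fun kl => by
    rw [Finset.union_empty]; exact dependsOn_gObs_staple ρ hρ β ha hj hq m kl.1 kl.2
  have hadep : ∀ i, DependsOn (coeff ρ hρ β i : GaugeConfig d L G → ℂ)
      ((posEdges ∪ crossEdges ∪ ∅ : Finset (Edge d L)) : Set (Edge d L)) := fun i => by
    rw [Finset.union_empty]; exact dependsOn_coeff ρ hL hρ β i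
  have hΘM : ∀ (U : GaugeConfig d L G), ∀ i ∈ (∅ : Finset (Edge d L)), U.timeReflect i = U i :=
    fun U i hi => absurd hi (Finset.notMem_empty i)
  have hCS := re_sum_pair_sq_le (haarProbability G) crossEdges GaugeConfig.timeReflect (coeff ρ hρ β)
    ∅ posEdges measurePreserving_timeReflect hΘM
    (fun e he => dependsOn_timeReflect_apply hL e he)
    (Finset.disjoint_empty_left _) (Finset.disjoint_empty_left _)
    (fun i => measurable_coeff ρ hρ β i) (fun i U => norm_coeff_le ρ hρ β i U) hadep
    hgpm hgqm hgpb hgqb hgpd hgqd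
  obtain ⟨h0, hsq⟩ := hCS
  have hκ : 0 ≤ Real.exp (-β * (N * Fintype.card (Plaquette d L))) * (N : ℝ)⁻¹ := by positivity
  refine ⟨mul_nonneg hκ h0, ?_⟩
  rw [mul_pow, mul_mul_mul_comm, ← sq]
  exact mul_le_mul_of_nonneg_left hsq (sq_nonneg _)

end Form

/-! ### The inequalities for the torus Wilson state -/

section Main

variable {j : Fin d}

/-- **Odd-height rectangular Wilson loops have non-negative expectation** in the torus Wilson
state (`L` even, `β ≥ 0`): `0 ≤ ⟨W_{(2p+1)×m}⟩_{Λ,β}` for `p + 1 ≤ L/2`, the loop lying in the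
`(0, j)` plane. (It is the reflection-positive square of an extended staple.)
(Osterwalder–Seiler 1978 §2; Seiler LNP 159 §2.) [folklore] -/
theorem wilsonExpectation_wilsonLoop_nonneg_of_odd (hL : Even L) (hρ : Continuous ρ) {β : ℝ}
    (hβ : 0 ≤ β) (hj : j ≠ 0) {p : ℕ} (hp : p + 1 ≤ L / 2) (m : ℕ) :
    0 ≤ wilsonExpectation ρ β (wilsonLoop ρ (0 : Site d L) 0 j (p + (p + 1)) m) := by
  have ha : (0 : Site d L) 0 = 0 := rfl
  rw [← wilsonExpectation_wilsonLoop_eq_zero_base ρ β ((0 : Site d L) + Pi.single 0 (-((p : ℕ) : ZMod L))),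
    wilsonExpectation_real_eq_toReal_mul_integral ρ hρ]
  exact mul_nonneg ENNReal.toReal_nonneg (wilsonIntegral_sq_le ρ hL hρ hβ ha hj hp hp m).1

/-- **Log-convexity of rectangular Wilson loops across the link planes** (torus Wilson state,
`L` even, `β ≥ 0`, loops in the `(0, j)` plane with `p + 1, q + 1 ≤ L/2`):
`⟨W_{(q+1+p)×m}⟩² ≤ ⟨W_{(2p+1)×m}⟩ · ⟨W_{(2q+1)×m}⟩`. This is the Schwarz inequality of
Osterwalder–Seiler reflection positivity in the hyperplane between time slices applied to the
extended staples, followed by translation invariance of the torus state (Osterwalder–Seiler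
1978 §2; Seiler LNP 159 §2, proof of the existence of the static quark potential). [folklore] -/
theorem wilsonExpectation_wilsonLoop_sq_le_of_link (hL : Even L) (hρ : Continuous ρ) {β : ℝ}
    (hβ : 0 ≤ β) (hj : j ≠ 0) {p q : ℕ} (hp : p + 1 ≤ L / 2) (hq : q + 1 ≤ L / 2) (m : ℕ) :
    wilsonExpectation ρ β (wilsonLoop ρ (0 : Site d L) 0 j (q + (p + 1)) m) ^ 2 ≤
      wilsonExpectation ρ β (wilsonLoop ρ (0 : Site d L) 0 j (p + (p + 1)) m) *
        wilsonExpectation ρ β (wilsonLoop ρ (0 : Site d L) 0 j (q + (q + 1)) m) := by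
  have ha : (0 : Site d L) 0 = 0 := rfl
  rw [← wilsonExpectation_wilsonLoop_eq_zero_base ρ β ((0 : Site d L) + Pi.single 0 (-((q : ℕ) : ZMod L)))
      0 j (q + (p + 1)),
    ← wilsonExpectation_wilsonLoop_eq_zero_base ρ β ((0 : Site d L) + Pi.single 0 (-((p : ℕ) : ZMod L)))
      0 j (p + (p + 1)),
    ← wilsonExpectation_wilsonLoop_eq_zero_base ρ β ((0 : Site d L) + Pi.single 0 (-((q : ℕ) : ZMod L)))
      0 j (q + (q + 1)),
    wilsonExpectation_real_eq_toReal_mul_integral ρ hρ, wilsonExpectation_real_eq_toReal_mul_integral ρ hρ,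
    wilsonExpectation_real_eq_toReal_mul_integral ρ hρ]
  obtain ⟨-, hsq⟩ := wilsonIntegral_sq_le ρ hL hρ hβ ha hj hp hq m
  rw [mul_pow, mul_mul_mul_comm, ← sq]
  exact mul_le_mul_of_nonneg_left hsq (sq_nonneg _)

end Main

end StringTension

end Literature.MathematicalPhysics.QuantumFieldTheory
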